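import Literature.AlgebraicGeometry.Motives.ZarhinHodgeGroupBlocks
import Literature.AlgebraicGeometry.Motives.ZarhinHodgeGroupAutC
import HarnessLib

/-!
# Galois transport of Zarhin's Lie algebra theorem from the distinguished block to all blocks (Zarhin's theorem, step 8)

Let `H` be an irreducible polarized `ℚ`-Hodge structure of K3 type on a finite-dimensional `V`,
`E = End_Hdg(V)`, `T_σ = eigenBlock H σ ⊆ V_ℂ` the blocks, `𝔥_ℂ = hodgeLieC H` the complexified Lie
algebra of the Hodge group. For a field automorphism `τ` of `ℂ` we let `τ ⊗ id` act on
`V_ℂ = ℂ ⊗_ℚ V` (`ℚ`-linearly, `τ`-semilinearly; written out as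
`(τ.toRingHom.toRatAlgHom.toLinearMap).rTensor V`). Since the Hodge group is defined over `ℚ`
(`𝔥_ℂ` is the `ℂ`-span of rational operators, `ZarhinHodgeGroupLieAlgebra`), `Ad(τ ⊗ id)`
preserves `𝔥_ℂ`; it maps `T_{σ}` onto `T_{τ ∘ σ}`, multiplies `ψ_ℂ` by `τ`, and sends a wedge
`x ∧ y` to `(τx) ∧ (τy)`. Hence (`wedge_mem_hodgeLieC_transport`): if `x ∧ y ∈ 𝔥_ℂ` for all
`x ∈ T_{α₀}`, `y ∈ T_{β₀}`, the same holds for `T_{τα₀}`, `T_{τβ₀}`. With the transitivity of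
`Aut(ℂ)` on the embeddings `E → ℂ` (`exists_ringEquiv_complex_comp_eq`, `E` a number field) and
the compatibility of `τ` with the conjugate embedding (`σ̄ = σ ∘ (adjoint)`, Zarhin's
`Zarhin1983_adjoint_eq_conj_holds`) we obtain Zarhin's Lie algebra theorem at EVERY block:

* `wedge_mem_hodgeLieC_of_mem_eigenBlock` (totally real case): `x ∧ y ∈ 𝔥_ℂ` for all
  `x, y ∈ T_σ`, every `σ` — i.e. `Lie(Hdg)_ℂ ⊇ ⊕_σ so(T_σ) = so_E(T, Ψ)_ℂ`;
* `wedge_mem_hodgeLieC_of_mem_eigenBlock_conj` (CM case): `x ∧ y ∈ 𝔥_ℂ` for all `x ∈ T_σ`,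
  `y ∈ T_σ̄`, every `σ` — i.e. `Lie(Hdg)_ℂ ⊇ u_E(T, Ψ)_ℂ`.

This is the "other blocks" half of Zarhin's comparison of dimensions (Zarhin 1983, §2, where
it is phrased through the `ℚ`-structure of `Hdg` and Galois conjugation; Huybrechts, *Lectures on
K3 Surfaces*, Thm. 3.3.9). No definitions, no named facts.

## References

* Yu. G. Zarhin, *Hodge groups of K3 surfaces*, J. reine angew. Math. 341 (1983), §2,
  Thms. 2.2.1, 2.3.1.
* D. Huybrechts, *Lectures on K3 Surfaces* (CUP 2016), Ch. 3, Thm. 3.3.9, Rem. 3.3.14.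
-/

noncomputable section

open scoped TensorProduct

namespace Literature.AlgebraicGeometry.Motives

namespace HodgeStructure

universe u

variable {V : Type u} [AddCommGroup V] [Module ℚ V]

/-! ### The semilinear action of `Aut(ℂ)` on `V_ℂ` -/

section AutTensor

variable (V) (τ : ℂ ≃+* ℂ)

/-- `(τ ⊗ id) (c ⊗ v) = τ c ⊗ v`. [folklore] -/
theorem autTensor_tmul (c : ℂ) (v : V) :
    (τ.toRingHom.toRatAlgHom.toLinearMap.rTensor V) (c ⊗ₜ[ℚ] v) = τ c ⊗ₜ[ℚ] v := by
  rw [LinearMap.rTensor_tmul]; rfl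

variable {V}

/-- `τ ⊗ id` is `τ`-semilinear. [folklore] -/
theorem autTensor_smul (c : ℂ) (x : ℂ ⊗[ℚ] V) :
    (τ.toRingHom.toRatAlgHom.toLinearMap.rTensor V) (c • x) =
      τ c • (τ.toRingHom.toRatAlgHom.toLinearMap.rTensor V) x := by
  induction x using TensorProduct.induction_on with
  | zero => simp
  | tmul a v =>
    rw [TensorProduct.smul_tmul', autTensor_tmul, autTensor_tmul, TensorProduct.smul_tmul',
      smul_eq_mul, smul_eq_mul, map_mul]
  | add x y hx hy => rw [smul_add, map_add, hx, hy, map_add, smul_add]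

/-- `(τ⁻¹ ⊗ id) ∘ (τ ⊗ id) = id`. [folklore] -/
theorem autTensor_symm_autTensor (x : ℂ ⊗[ℚ] V) :
    (τ.symm.toRingHom.toRatAlgHom.toLinearMap.rTensor V)
      ((τ.toRingHom.toRatAlgHom.toLinearMap.rTensor V) x) = x := by
  induction x using TensorProduct.induction_on with
  | zero => simp
  | tmul a v => rw [autTensor_tmul, autTensor_tmul]; simp
  | add x y hx hy => rw [map_add, map_add, hx, hy]

/-- `(τ ⊗ id) ∘ (τ⁻¹ ⊗ id) = id`. [folklore] -/
theorem autTensor_autTensor_symm (x : ℂ ⊗[ℚ] V) :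
    (τ.toRingHom.toRatAlgHom.toLinearMap.rTensor V)
      ((τ.symm.toRingHom.toRatAlgHom.toLinearMap.rTensor V) x) = x := by
  have h := autTensor_symm_autTensor τ.symm x
  rwa [RingEquiv.symm_symm] at h

/-- `τ ⊗ id` commutes with the complexification of every rational endomorphism. [folklore] -/
theorem autTensor_baseChange (X : Module.End ℚ V) (x : ℂ ⊗[ℚ] V) :
    (τ.toRingHom.toRatAlgHom.toLinearMap.rTensor V) (X.baseChange ℂ x) =
      X.baseChange ℂ ((τ.toRingHom.toRatAlgHom.toLinearMap.rTensor V) x) := by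
  induction x using TensorProduct.induction_on with
  | zero => simp
  | tmul a v => rw [LinearMap.baseChange_tmul, autTensor_tmul, autTensor_tmul, LinearMap.baseChange_tmul]
  | add x y hx hy => rw [map_add, map_add, hx, hy, map_add, map_add]

/-- `τ ⊗ id` multiplies the complexification of a rational bilinear form by `τ`:
`B_ℂ(τx, τy) = τ (B_ℂ(x, y))`. [folklore] -/
theorem form_autTensor (B : LinearMap.BilinForm ℚ V) (x y : ℂ ⊗[ℚ] V) :
    B.baseChange ℂ ((τ.toRingHom.toRatAlgHom.toLinearMap.rTensor V) x)
      ((τ.toRingHom.toRatAlgHom.toLinearMap.rTensor V) y) = τ (B.baseChange ℂ x y) := by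
  induction x using TensorProduct.induction_on with
  | zero => simp
  | tmul a v =>
    induction y using TensorProduct.induction_on with
    | zero => simp
    | tmul b w =>
      rw [autTensor_tmul, autTensor_tmul, LinearMap.BilinForm.baseChange_tmul,
        LinearMap.BilinForm.baseChange_tmul, Rat.smul_def, Rat.smul_def, map_mul, map_mul,
        map_ratCast]
    | add y y' hy hy' => rw [map_add, map_add, hy, hy', map_add, map_add]
  | add x x' hx hx' =>
    rw [map_add, map_add, LinearMap.add_apply, hx, hx', map_add, LinearMap.add_apply, map_add]

end AutTensor

/-! ### `Ad(τ ⊗ id)` preserves `𝔥_ℂ` and transports wedges between blocks -/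

section Transport

variable [Module.Finite ℚ V] [HodgeTensorFacts.{u, u}] {n : ℤ}

omit [Module.Finite ℚ V] [HodgeTensorFacts.{u, u}] in
/-- **`τ ⊗ id` maps the block `T_σ` into `T_{τ ∘ σ}`**. [cite: Huybrechts2016K3, Rem. 3.3.14 (iii)] -/
theorem autTensor_mem_eigenBlock (H : HodgeStructure V n) (τ : ℂ ≃+* ℂ) {σ : H.endAlg →+* ℂ}
    {x : ℂ ⊗[ℚ] V} (hx : x ∈ H.eigenBlock σ) :
    (τ.toRingHom.toRatAlgHom.toLinearMap.rTensor V) x ∈ H.eigenBlock (τ.toRingHom.comp σ) := by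
  rw [mem_eigenBlock_iff] at hx ⊢
  intro a
  rw [← autTensor_baseChange, hx a, autTensor_smul]
  rfl

/-- **Transport of the block statement along `τ ∈ Aut(ℂ)`.** If `x ∧ y ∈ 𝔥_ℂ` for all
`x ∈ T_{α₀}`, `y ∈ T_{β₀}`, and `τ ∘ α₀ = α`, `τ ∘ β₀ = β`, then `x ∧ y ∈ 𝔥_ℂ` for all `x ∈ T_α`,
`y ∈ T_β`. Proof: `x = (τ ⊗ 1) x₀`, `y = (τ ⊗ 1) y₀` with `x₀ ∈ T_{α₀}`, `y₀ ∈ T_{β₀}`;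
`Ad(τ ⊗ 1)` fixes every rational operator, hence preserves `𝔥_ℂ = span_ℂ {X_ℂ}` ("`Hdg` is
defined over `ℚ`", Zarhin 1983, §2), and `Ad(τ ⊗ 1)(x₀ ∧ y₀) = x ∧ y` since
`ψ_ℂ(τ u, τ v) = τ ψ_ℂ(u, v)`. [cite: Zarhin1983HodgeGroupsK3, §2] -/
theorem wedge_mem_hodgeLieC_transport (H : HodgeStructure V n) (ψ : H.Polarization)
    (τ : ℂ ≃+* ℂ) {α₀ β₀ α β : H.endAlg →+* ℂ} (hα : τ.toRingHom.comp α₀ = α)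
    (hβ : τ.toRingHom.comp β₀ = β)
    (h₀ : ∀ x ∈ H.eigenBlock α₀, ∀ y ∈ H.eigenBlock β₀,
      (LinearMap.smulRight (ψ.form.baseChange ℂ y) x - LinearMap.smulRight (ψ.form.baseChange ℂ x) y :
        Module.End ℂ (ℂ ⊗[ℚ] V)) ∈ H.hodgeLieC)
    {x y : ℂ ⊗[ℚ] V} (hx : x ∈ H.eigenBlock α) (hy : y ∈ H.eigenBlock β) :
    (LinearMap.smulRight (ψ.form.baseChange ℂ y) x - LinearMap.smulRight (ψ.form.baseChange ℂ x) y :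
      Module.End ℂ (ℂ ⊗[ℚ] V)) ∈ H.hodgeLieC := by
  set T := τ.toRingHom.toRatAlgHom.toLinearMap.rTensor V with hT
  set T' := τ.symm.toRingHom.toRatAlgHom.toLinearMap.rTensor V with hT'
  have hTT' : ∀ w, T (T' w) = w := autTensor_autTensor_symm τ
  have hT'T : ∀ w, T' (T w) = w := autTensor_symm_autTensor τ
  -- `x₀ = T' x ∈ T_{α₀}`, `y₀ = T' y ∈ T_{β₀}`
  have hα₀ : τ.symm.toRingHom.comp α = α₀ := by
    rw [← hα]; ext a; simp
  have hβ₀ : τ.symm.toRingHom.comp β = β₀ := by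
    rw [← hβ]; ext a; simp
  have hx₀ : T' x ∈ H.eigenBlock α₀ := hα₀ ▸ H.autTensor_mem_eigenBlock τ.symm hx
  have hy₀ : T' y ∈ H.eigenBlock β₀ := hβ₀ ▸ H.autTensor_mem_eigenBlock τ.symm hy
  have hmem := h₀ _ hx₀ _ hy₀
  -- `Ad(T)` as an operation on `ℂ`-linear endomorphisms
  let ad : Module.End ℂ (ℂ ⊗[ℚ] V) → Module.End ℂ (ℂ ⊗[ℚ] V) := fun Z =>
    { toFun := fun w => T (Z (T' w))
      map_add' := fun w w' => by rw [map_add, map_add, map_add]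
      map_smul' := fun c w => by
        rw [RingHom.id_apply, hT', autTensor_smul, map_smul, hT, autTensor_smul]
        simp }
  have had : ∀ Z w, ad Z w = T (Z (T' w)) := fun Z w => rfl
  -- `Ad(T)` preserves `𝔥_ℂ`
  have hpres : ∀ Z ∈ H.hodgeLieC, ad Z ∈ H.hodgeLieC := by
    intro Z hZ
    induction hZ using Submodule.span_induction with
    | mem Z hZ =>
      obtain ⟨X, hX, rfl⟩ := hZ
      have : ad (X.baseChange ℂ) = X.baseChange ℂ := by
        apply LinearMap.ext fun w => ?_
        rw [had, hT, autTensor_baseChange, ← hT, hTT']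
      rw [this]
      exact H.baseChange_mem_hodgeLieC hX
    | zero =>
      have : ad 0 = 0 := LinearMap.ext fun w => by rw [had]; simp
      rw [this]; exact H.hodgeLieC.zero_mem
    | add Z Z' _ _ hZ hZ' =>
      have : ad (Z + Z') = ad Z + ad Z' := LinearMap.ext fun w => by
        simp only [had, LinearMap.add_apply, map_add]
      rw [this]; exact H.hodgeLieC.add_mem hZ hZ'
    | smul c Z _ hZ =>
      have : ad (c • Z) = τ c • ad Z := LinearMap.ext fun w => by
        simp only [had, LinearMap.smul_apply, hT, autTensor_smul]
      rw [this]; exact H.hodgeLieC.smul_mem _ hZ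
  -- `Ad(T)` of the wedge of `x₀, y₀` is the wedge of `x, y`
  have hwedge : ad (LinearMap.smulRight (ψ.form.baseChange ℂ (T' y)) (T' x) -
      LinearMap.smulRight (ψ.form.baseChange ℂ (T' x)) (T' y)) =
      (LinearMap.smulRight (ψ.form.baseChange ℂ y) x - LinearMap.smulRight (ψ.form.baseChange ℂ x) y :
        Module.End ℂ (ℂ ⊗[ℚ] V)) := by
    have hform : ∀ a b, τ (ψ.form.baseChange ℂ (T' a) (T' b)) = ψ.form.baseChange ℂ a b := by
      intro a b
      have h := form_autTensor τ ψ.form (T' a) (T' b)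
      rw [← hT, hTT', hTT'] at h
      exact h.symm
    apply LinearMap.ext fun w => ?_
    rw [had]
    simp only [LinearMap.sub_apply, LinearMap.smulRight_apply, map_sub, hT, autTensor_smul]
    rw [← hT, hTT', hTT', ← hform y w, ← hform x w]
  rw [← hwedge]
  exact hpres _ hmem

omit [HodgeTensorFacts.{u, u}] in
/-- `End_Hdg(V)` of a Hodge structure on a finite-dimensional `V` is countable. [folklore] -/
theorem countable_endAlg (H : HodgeStructure V n) : Countable H.endAlg := by
  haveI : Module.Finite ℚ H.endAlg := finiteDimensional_endAlg H
  exact Countable.of_equiv _ (Module.finBasis ℚ H.endAlg).equivFun.toEquiv.symm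

omit [HodgeTensorFacts.{u, u}] in
/-- **Compatibility of `Aut(ℂ)` with the conjugate embedding** (K3 type): if `τ ∘ σ₀ = σ` then
`τ ∘ σ̄₀ = σ̄`, because `σ̄(a) = conj σ(a) = σ(a')` for an adjoint `a'` of `a` and every
embedding `σ` (Zarhin; Huybrechts Thm. 3.3.7 / Rem. 3.3.14 (i), `Zarhin1983_adjoint_eq_conj_holds`).
[cite: Huybrechts2016K3, Rem. 3.3.14 (i)] -/
theorem ringEquiv_comp_starRingEnd_comp {H : HodgeStructure V 2} (hirr : H.IsIrreducible)
    (hK3 : H.IsOfK3Type) (ψ : H.Polarization) (τ : ℂ ≃+* ℂ) {σ₀ σ : H.endAlg →+* ℂ}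
    (hτ : τ.toRingHom.comp σ₀ = σ) :
    τ.toRingHom.comp ((starRingEnd ℂ).comp σ₀) = (starRingEnd ℂ).comp σ := by
  obtain ⟨hex, hconj⟩ := Zarhin1983_adjoint_eq_conj_holds H hirr hK3 ψ
  ext a
  obtain ⟨a', hadj⟩ := hex a
  simp only [RingHom.comp_apply]
  rw [← hconj a a' hadj σ₀, ← hconj a a' hadj σ, ← hτ]
  rfl

/-- **Zarhin's Lie algebra theorem, totally real case, at every block**: `x ∧ y ∈ Lie(Hdg)_ℂ`
for all `x, y ∈ T_σ` and every `σ : E → ℂ` — `Lie(Hdg)_ℂ ⊇ ⊕_σ so(T_σ, ψ_ℂ) = so_E(T, Ψ) ⊗ ℂ`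
(Zarhin 1983, Thm. 2.2.1; Huybrechts Thm. 3.3.9: "comparison of dimensions"). From the distinguished
block (`wedge_mem_hodgeLieC_of_mem_eigenBlock_eps`) by transport along `τ ∈ Aut(ℂ)` with
`τ ∘ ε = σ` (`exists_ringEquiv_complex_comp_eq`). [cite: Zarhin1983HodgeGroupsK3, Thm. 2.2.1]
[cite: Huybrechts2016K3, Thm. 3.3.9] -/
theorem wedge_mem_hodgeLieC_of_mem_eigenBlock {H : HodgeStructure V 2} (hirr : H.IsIrreducible)
    (hK3 : H.IsOfK3Type) (ψ : H.Polarization)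
    (hself : ∀ a : H.endAlg,
      LinearMap.IsAdjointPair ψ.form ψ.form (a : Module.End ℚ V) (a : Module.End ℚ V))
    (σ : H.endAlg →+* ℂ) {x y : ℂ ⊗[ℚ] V} (hx : x ∈ H.eigenBlock σ) (hy : y ∈ H.eigenBlock σ) :
    (LinearMap.smulRight (ψ.form.baseChange ℂ y) x - LinearMap.smulRight (ψ.form.baseChange ℂ x) y :
      Module.End ℂ (ℂ ⊗[ℚ] V)) ∈ H.hodgeLieC := by
  obtain ⟨ε, hε⟩ := exists_eps_piece_le_eigenBlock hK3
  haveI := countable_endAlg H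
  letI : Field H.endAlg := (Zarhin1983_endAlg_isField_holds H hirr hK3).1.toField
  obtain ⟨τ, hτ⟩ := ZarhinLie.exists_ringEquiv_complex_comp_eq ε σ
  have hτ' : τ.toRingHom.comp ε = σ := RingHom.ext hτ
  exact wedge_mem_hodgeLieC_transport H ψ τ hτ' hτ'
    (fun x hx y hy => wedge_mem_hodgeLieC_of_mem_eigenBlock_eps hirr hK3 ψ hself hε hx hy) hx hy

/-- **Zarhin's Lie algebra theorem, CM case, at every block**: `x ∧ y ∈ Lie(Hdg)_ℂ` for all
`x ∈ T_σ`, `y ∈ T_σ̄` and every `σ` — `Lie(Hdg)_ℂ ⊇ u_E(T, Ψ) ⊗ ℂ` (Zarhin 1983, Thm. 2.3.1;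
Huybrechts Thm. 3.3.9, CM case). From the distinguished pair of blocks
(`wedge_mem_hodgeLieC_of_mem_eigenBlock_eps_conj`) by transport, using
`ringEquiv_comp_starRingEnd_comp`. [cite: Zarhin1983HodgeGroupsK3, Thm. 2.3.1]
[cite: Huybrechts2016K3, Thm. 3.3.9] -/
theorem wedge_mem_hodgeLieC_of_mem_eigenBlock_conj {H : HodgeStructure V 2} (hirr : H.IsIrreducible)
    (hK3 : H.IsOfK3Type) (ψ : H.Polarization) {a₀ : H.endAlg}
    (ha₀ : ¬ LinearMap.IsAdjointPair ψ.form ψ.form (a₀ : Module.End ℚ V) (a₀ : Module.End ℚ V))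
    (σ : H.endAlg →+* ℂ) {x y : ℂ ⊗[ℚ] V} (hx : x ∈ H.eigenBlock σ)
    (hy : y ∈ H.eigenBlock ((starRingEnd ℂ).comp σ)) :
    (LinearMap.smulRight (ψ.form.baseChange ℂ y) x - LinearMap.smulRight (ψ.form.baseChange ℂ x) y :
      Module.End ℂ (ℂ ⊗[ℚ] V)) ∈ H.hodgeLieC := by
  obtain ⟨ε, hε⟩ := exists_eps_piece_le_eigenBlock hK3
  haveI := countable_endAlg H
  letI : Field H.endAlg := (Zarhin1983_endAlg_isField_holds H hirr hK3).1.toField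
  obtain ⟨τ, hτ⟩ := ZarhinLie.exists_ringEquiv_complex_comp_eq ε σ
  have hτ' : τ.toRingHom.comp ε = σ := RingHom.ext hτ
  exact wedge_mem_hodgeLieC_transport H ψ τ hτ' (ringEquiv_comp_starRingEnd_comp hirr hK3 ψ τ hτ')
    (fun x hx y hy => wedge_mem_hodgeLieC_of_mem_eigenBlock_eps_conj hirr hK3 ψ ha₀ hε hx hy) hx hy

end Transport


end HodgeStructure

end Literature.AlgebraicGeometry.Motives

end
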